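import Literature.AlgebraicGeometry.Motives.GeneralizedTateConjecture
import Literature.AlgebraicGeometry.Motives.AbelianVarietyProduct
import Literature.AlgebraicGeometry.Motives.AbelianVarietyProjectiveChart
import Literature.AlgebraicGeometry.Milne1999.HodgeCMImpliesTateFiniteFields
import HarnessLib

/-!
# Milne–Ramachandran 2006, Theorem 1.10 / Corollary 1.11: the Tate conjecture for all `A × X`
# (`A` abelian) implies the generalized Tate conjecture for `X`; hence, with Milne 1999 Thm. 7.1,
# the Hodge conjecture for complex CM abelian varieties implies the GENERALIZED Tate conjecture for
# every abelian variety over every finite field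

J. S. Milne, N. Ramachandran, *Motivic complexes over finite fields and the ring of correspondences at
the generic point*, Pure Appl. Math. Q. 5 (2009) = arXiv:math/0607483 [MilneRamachandran2006], §1.2
"The Tate conjecture implies the generalized Tate conjecture" (held text `arXiv:math/0607483`, chunk
p0004); the same statement is Thm. 1.4 of J. S. Milne, *The Tate conjecture over finite fields (AIM
talk)*, arXiv:0709.3040 [Milne2007TateFiniteFieldsAIM] ("The proof is explained in [milneR2006],
1.10."). This file TYPES the two printed implications at statement level, in the standing of
`Milne1999.Theorem71` (`Milne1999/HodgeCMImpliesTateFiniteFields`): `E`-parametrised cited PREDICATES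
over the ℓ-adic data `E k ℓ : GaloisWeilCohomology k ℚ_[ℓ] (padicCyclotomicCharacter k ℓ)` (one for
every finite field `k` and prime `ℓ ≠ char k`), asserted by nobody — theorems in print at the intended
`E` (étale cohomology), not for arbitrary data of that type —, and records the COMPOSITION with
Milne 1999 Thm. 7.1 as kernel-visible edges by modus ponens (`generalizedTate_AV_of_tateStatement01`,
`generalizedTate_AV_Fq_of_HC_CM`). Nothing of the proof (Honda–Tate, Prop. 1.7; Lemmas 1.8–1.9) is
formalised.

## The source, verbatim (arXiv:math/0607483 §1, chunk p0004 of the held text)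

* Plain 1.1 (p0003 L6–L27): "`T^r(X,l)`: the cycle class map `Z^r(X) ⊗ ℚ_l → H^{2r}_l(X)(r)^{Gal(𝔽/k)}` is
  surjective […]. The statement `T^r(X,l)` is the Tate conjecture for `X`, `r`, and `l`." — the tree's
  `GaloisWeilCohomology.TateConjectureFor X r` (`Motives/GaloisRealization`: the `ℚ_ℓ`-span of the
  classes of `k`-rational codimension-`r` cycles is the whole of the Galois invariants of `H^{2r}(X)(r)`).
* Theorem 1.10 (p0004 L117–L121): "Let `X` be a smooth complete variety over `k`. If the Tate
  conjecture holds for all varieties of the form `A × X` with `A` an abelian variety (and some `l`), then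
  the generalized Tate conjecture holds for `X` (and the same `l`)." (Proof, L123–L125: "As we noted
  above, `H*_l(A)` is a semisimple, and so this follows from (1.7) and (1.9)." — Lemma 1.9 uses
  `T^{dim(T)+r}(T × X, l)` for `T` an abelian variety.)
* Corollary 1.11 (p0004 L127–L130): "If the Tate conjecture holds for all abelian varieties over `k` (or
  for all smooth complete varieties over `k`) and some `l`, then the generalized Tate conjecture holds
  for the same class and that `l`."
* Milne AIM Thm. 1.4 (arXiv:0709.3040, chunk p0004 L93–L99): "Let `X` be a variety over `𝔽`. If the Tate
  conjecture holds for all varieties of the form `A × X` with `A` an abelian variety (and some `ℓ`),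
  then the generalized Tate conjecture holds for `X` (and the same `ℓ`). The proof is explained in
  [milneR2006], 1.10."
* Milne 1999 [Milne1999] Thm. 7.1 p. 72 and (0.1) p. 46 ("Statement (0.1) for `A` implies the similar
  statements for any model `A₀` of `A` over a finite field — specifically, it implies the statements
  denoted `E(A₀)` and `T(A₀)` in Tate 1994"): typed as `Milne1999.Theorem71 E` /
  `Milne1999.TateStatement01 E` (per model: `T^r(A/k)` and `D(A)` for every abelian variety `A` over
  every finite field `k`, every `r`, every `ℓ ≠ char k`).

## Lean rendering

* `Theorem110 E` : for every finite field `k`, prime `ℓ ≠ char k`, every smooth projective `X/k` (of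
  some dimension `n`): if `T^r(A ×ₖ X, ℓ)` holds for every abelian variety `A/k` and every `r`, then
  `(E k ℓ).GeneralizedTateStatementFor X` (`Motives/GeneralizedTateConjecture`: `F^r_b Hⁱ(X) ⊆ F^r_a Hⁱ(X)`
  for all `i, r`). "Smooth complete" is rendered by the tree's `IsSmoothProjective` (a narrower class,
  so the rendered statement is implied by the printed one); `A × X` is the product `A.X ⊗ X` in the
  cartesian monoidal category `SchemeOver k = Over (Spec k)` (fibre product over `k`), the object
  underlying `AbelianVariety.prod` (`Motives/AbelianVarietyProduct`, `prod_X : (A.prod B).X = A.X ⊗ B.X`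
  by `rfl`).
* `Corollary111 E` : the first alternative of Cor. 1.11 (class = abelian varieties): for every `k`,
  `ℓ`: `T^r(A, ℓ)` for all abelian varieties `A/k` and all `r` ⟹ the generalized Tate conjecture for
  every abelian variety `B/k`. PROVED from `Theorem110 E` (`corollary111_of_theorem110`) exactly as in
  print: `A ×ₖ B` is an abelian variety (`AbelianVariety.prod`) and `B` is smooth projective
  (`AbelianVariety.isSmoothProjective_holds`).
* The edges: `generalizedTate_AV_of_tateStatement01` (Milne's (0.1) for all abelian varieties over all
  finite fields ⟹ generalized Tate for all of them — reader's-map "row 1 ⟹ row 16" of the pub-hodgecm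
  consequence file) and `generalizedTate_AV_Fq_of_HC_CM` (HC for complex CM abelian varieties ⟹
  generalized Tate for abelian varieties over finite fields, through `Milne1999.Theorem71`).

## What is NOT here

* The second alternative of Cor. 1.11 (all smooth complete varieties), the `p`-adic analogue (Plain
  1.15, printed for the all-varieties hypothesis only) and Plain 1.16 (number fields, needs an
  effective Fontaine–Mazur conjecture). No `_holds` is owed or claimed for the two predicates (they are
  theorems in print at the intended `E`, not named facts about arbitrary `E`; cf. the standing note in
  `Milne1999/HodgeCMImpliesTateFiniteFields`).

## References

* [MilneRamachandran2006] §1: Plain 1.1, Thm. 1.10, Cor. 1.11 (arXiv:math/0607483, chunk p0004).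
* [Milne2007TateFiniteFieldsAIM] Thm. 1.4. [Milne1999] Thm. 7.1 (p. 72), (0.1) (p. 46).
-/

noncomputable section

open CategoryTheory AlgebraicGeometry MonoidalCategory
open Literature.AlgebraicGeometry.Motives

namespace Literature.AlgebraicGeometry.MilneRamachandran2006

/-- **Milne–Ramachandran 2006, Theorem 1.10** (= Milne, AIM talk, Thm. 1.4), quoted verbatim in the
module docstring: for a smooth complete variety `X` over the finite field `k`, Tate's statements
`T^r(A × X, l)` for all abelian varieties `A/k` (all `r`, one `l`) imply the generalized (coniveau)
Tate statement `GT(X)` (`F^r_b Hⁱ(X) ⊆ F^r_a Hⁱ(X)` for all `i, r`) for that `l`. An `E`-parametrised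
cited PREDICATE over the ℓ-adic data (the standing of `Milne1999.Theorem71`): a THEOREM in print at
the intended `E`, not asserted for arbitrary data of this type; "smooth complete" rendered as
`IsSmoothProjective`, `A × X` as the fibre product `A.X ⊗ X` in `Over (Spec k)`.
[cite: MilneRamachandran2006, Thm. 1.10] [cite: Milne2007TateFiniteFieldsAIM, Thm. 1.4] -/
def Theorem110
    (E : ∀ (k : Type) [Field k] [Finite k] (ℓ : ℕ) [Fact ℓ.Prime] [NeZero (ℓ : k)],
      GaloisWeilCohomology k ℚ_[ℓ] (padicCyclotomicCharacter k ℓ)) : Prop :=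
  ∀ (k : Type) [Field k] [Finite k] (ℓ : ℕ) [Fact ℓ.Prime] [NeZero (ℓ : k)]
    (n : ℕ) (X : SchemeOver k), IsSmoothProjective n X →
    (∀ (A : AbelianVariety k) (r : ℕ), (E k ℓ).TateConjectureFor (A.X ⊗ X) r) →
      (E k ℓ).GeneralizedTateStatementFor X

/-- **Milne–Ramachandran 2006, Corollary 1.11, first alternative** (quoted verbatim in the module
docstring): if Tate's statement `T^r(A, l)` holds for all abelian varieties `A` over `k` (all `r`,
one `l`), then the generalized (coniveau) Tate statement `GT(B)` holds for all abelian varieties `B`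
over `k` and that `l`. An `E`-parametrised cited PREDICATE (same standing as `Theorem110`: a THEOREM in
print at the intended `E`), PROVED below from `Theorem110` as in print. [cite: MilneRamachandran2006, Cor. 1.11] -/
def Corollary111
    (E : ∀ (k : Type) [Field k] [Finite k] (ℓ : ℕ) [Fact ℓ.Prime] [NeZero (ℓ : k)],
      GaloisWeilCohomology k ℚ_[ℓ] (padicCyclotomicCharacter k ℓ)) : Prop :=
  ∀ (k : Type) [Field k] [Finite k] (ℓ : ℕ) [Fact ℓ.Prime] [NeZero (ℓ : k)],
    (∀ (A : AbelianVariety k) (r : ℕ), (E k ℓ).TateConjectureFor A.X r) →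
      ∀ B : AbelianVariety k, (E k ℓ).GeneralizedTateStatementFor B.X

/-- **Cor. 1.11 from Thm. 1.10** (the printed deduction: for abelian varieties `A`, `B` over `k`,
`A × B` is an abelian variety — the tree's `AbelianVariety.prod`, whose underlying `k`-scheme is
`A.X ⊗ B.X` by `rfl` — and `B` is smooth projective, `AbelianVariety.isSmoothProjective_holds`).
[cite: MilneRamachandran2006, Cor. 1.11] -/
theorem corollary111_of_theorem110
    {E : ∀ (k : Type) [Field k] [Finite k] (ℓ : ℕ) [Fact ℓ.Prime] [NeZero (ℓ : k)],
      GaloisWeilCohomology k ℚ_[ℓ] (padicCyclotomicCharacter k ℓ)}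
    (h110 : Theorem110 E) : Corollary111 E := by
  intro k _ _ ℓ _ _ hT B
  refine h110 k ℓ B.dim B.X AbelianVariety.isSmoothProjective_holds ?_
  intro A r
  simpa only [AbelianVariety.prod_X] using hT (A.prod B) r

/-- **The edge row 1 ⟹ row 16, by name.** Milne's statement (0.1) for every abelian variety over every
finite field (`Milne1999.TateStatement01 E`: `T^r` and `D` per model) and Milne–Ramachandran's
Thm. 1.10 at the same ℓ-adic data give the generalized Tate conjecture for every abelian variety over
every finite field and every `ℓ ≠ p`. [cite: MilneRamachandran2006, Cor. 1.11] [cite: Milne1999, (0.1) p. 46] -/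
theorem generalizedTate_AV_of_tateStatement01
    {E : ∀ (k : Type) [Field k] [Finite k] (ℓ : ℕ) [Fact ℓ.Prime] [NeZero (ℓ : k)],
      GaloisWeilCohomology k ℚ_[ℓ] (padicCyclotomicCharacter k ℓ)}
    (h110 : Theorem110 E) (hT : Milne1999.TateStatement01 E)
    (k : Type) [Field k] [Finite k] (ℓ : ℕ) [Fact ℓ.Prime] [NeZero (ℓ : k)]
    (B : AbelianVariety k) : (E k ℓ).GeneralizedTateStatementFor B.X :=
  corollary111_of_theorem110 h110 k ℓ (fun A r ↦ (hT k ℓ A r).1) B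

/-- **The edge HC_CM ⟹ generalized Tate(AV/𝔽_q), by name.** Given Milne's Theorem 7.1 and
Milne–Ramachandran's Theorem 1.10 at the ℓ-adic data `E`, the Hodge conjecture for every complex
abelian variety of CM-type (`∀ A, Milne1999.CMHodgeHypothesisAt A`, = the Summits item
`RankFourFaces.CMAbelianHodge` definitionally) implies the generalized Tate conjecture
(`F^r_b Hⁱ ⊆ F^r_a Hⁱ` for all `i, r`) for every abelian variety over every finite field and every
`ℓ ≠ p` — the composition of the two printed implications Milne 1999 Thm. 7.1 and
Milne–Ramachandran 2006 Cor. 1.11, nothing else.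
[cite: MilneRamachandran2006, Cor. 1.11] [cite: Milne1999, Thm. 7.1 p. 72] -/
theorem generalizedTate_AV_Fq_of_HC_CM
    {E : ∀ (k : Type) [Field k] [Finite k] (ℓ : ℕ) [Fact ℓ.Prime] [NeZero (ℓ : k)],
      GaloisWeilCohomology k ℚ_[ℓ] (padicCyclotomicCharacter k ℓ)}
    (h71 : Milne1999.Theorem71 E) (h110 : Theorem110 E)
    (hHC : ∀ A : AbelianVariety ℂ, Milne1999.CMHodgeHypothesisAt A)
    (k : Type) [Field k] [Finite k] (ℓ : ℕ) [Fact ℓ.Prime] [NeZero (ℓ : k)]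
    (B : AbelianVariety k) : (E k ℓ).GeneralizedTateStatementFor B.X :=
  generalizedTate_AV_of_tateStatement01 h110 (Milne1999.tateAV_Fq_of_HC_CM h71 hHC) k ℓ B

/-- Pointwise unpacking of the last edge: GIVEN HC for complex CM abelian varieties (and the two cited
theorems at `E`), every `ϖ`-stable subspace of `Hⁱ(B)` (`B` an abelian variety over a finite field)
whose `r`-th twist is effective and semisimple is supported in codimension `≥ r` — Conj. 1.3 as
printed, for abelian varieties. [cite: MilneRamachandran2006, Conj. 1.3 and Cor. 1.11] -/
theorem le_coniveauFiltration_of_HC_CM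
    {E : ∀ (k : Type) [Field k] [Finite k] (ℓ : ℕ) [Fact ℓ.Prime] [NeZero (ℓ : k)],
      GaloisWeilCohomology k ℚ_[ℓ] (padicCyclotomicCharacter k ℓ)}
    (h71 : Milne1999.Theorem71 E) (h110 : Theorem110 E)
    (hHC : ∀ A : AbelianVariety ℂ, Milne1999.CMHodgeHypothesisAt A)
    (k : Type) [Field k] [Finite k] (ℓ : ℕ) [Fact ℓ.Prime] [NeZero (ℓ : k)]
    (B : AbelianVariety k) {i r : ℕ} {V : Submodule ℚ_[ℓ] ((E k ℓ).obj B.X i)}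
    (hV : (E k ℓ).IsEffectiveTwistSubspace B.X i r V) :
    V ≤ (E k ℓ).coniveauFiltration B.X i r :=
  (generalizedTate_AV_Fq_of_HC_CM h71 h110 hHC k ℓ B).le_coniveauFiltration hV

end Literature.AlgebraicGeometry.MilneRamachandran2006

end
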